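import Summits.QuantumFields.YangMills.Theorems.UnitScaleTiltProp7ChartRayContinuityT3
import Summits.QuantumFields.YangMills.Theorems.UnitScaleTiltProp7Row79AtMemberPInvT3
import Summits.QuantumFields.YangMills.Theorems.UnitScaleTiltProp7FibreELOfCritSplit
import HarnessLib

/-!
# Route `UnitScaleTilt`, crux «MinimiserStabilityRegPr» (stmt-QuantumFields-19200, stub EX `stub_existenceMinimalOrbit`, route (α)) — «HCHART-HXR-PINV»: **THE TWO EVENTUAL ROWS `hchart`, `hXR`
# OF ✓`Prop7Eq128AtMemberOfCrit127` (p677812) ∕ ✓`Prop7Crit93AtMemberOfRow84` (p669617) AT THE PINV LETTERS OF THE EX DISPLAY** (`H := H46P`, `H̃ᴾ := H1f …DeltaPiSlotP… U₀`; S9″ ✓p676326 ∕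
# S11): (G22)ᴾ — the pinv twin of ✓`Prop7SectET3WChartConj.smul_iota_T47_eq_chart` (ym3-torus-px14 ✓p664462) — `κ_f • ι(T47 H̃ᴾ C̃ εC A′) = χᴾ(κ_f • ιA′)`,
# `χᴾ X := X − H46P U₀ (Dfix (CmapTwS U₀) (H46P U₀) C₂ X)`, made EVENTUAL along the ray by ✓`Prop7ChartRayContinuity.eventually_chart_eq_of_pointwise` (px21 g2 ✓p669484); and the reality (51)
# ✓`Prop7FibreELOfCritSplit.isHermitian_trace_zero_chartTwS` made EVENTUAL along the ray `X + tδ` (generic linear `H`).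

Cell `ym3-torus` (HUMAN RULING D-0037, YM ladder rung R3 — YM₃ on T³, NOT d = 4, NOT Clay; YM gap NOT proved), width seat `ym3-torus-px21` gen 3 (explicit-unit helper; lineage px21 g0∕g2∕g3).
THEOREMS ONLY (0 `def`, 0 `sorry`); `--supports stmt-QuantumFields-19200 --as helper`, count-neutral; NO claim on crux ∕ stub ∕ registry.

THE PRINT.  [Balaban1985Variational] (47)–(49) p. 285 «A = A′ − HD(A′) … C_j(LʲηA′ − LʲηHD(A′)) = D(A′)», (51) p. 286 (the chart values are `𝔤`-valued), (55) p. 286 (uniqueness ball of `D`),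
(80) p. 290, (82)–(84) p. 290 (the ray `A′ + tδA′`), (112) p. 294.  The EX display of record writes the chart through the pinv letters `H46P`∕`DeltaPiSlotP` (★★OWNER RULING g28-№4 (C2′));
(W-X′)'s J-term letter is `H̃ᴾ := H1f …DeltaPiSlotP… U₀` (✓`Prop7Rows84AtEtaSlot`, ✓`Prop7Row84AtEtaSlotMember`), so the lattice chart inside (84) is `T47 H̃ᴾ C̃ εC` and the conjugacy needed by
the assemblies is the pinv twin of (G22) — same proof, units identity ✓`Prop7Row79AtMemberPInv.smul_iota_H1f_eq_H46P_smul`.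
WHAT IS PROVED (member `F`, `K n`, `h : n ≤ K`, weights `c₀ cB a`; `U₀ : GaugeField (F.P K) 0 SU(2)`; `κ_f := (η:ℂ)·I`; ns `…Theorems.Prop7ChartConjPInv`):
* §1 ★★ `smul_iota_Dfix_eq_pinv` — `I • Dfix C̃ ↑H̃ᴾ C₂′ A′ = Dfix (CmapTwS U₀) (H46P U₀) C₂ (κ_f • ιA′)` (✓`map_Dfix_eq_Dfix_of_conj`; both B13 regimes + nesting DISPLAYED).
* §2 ★★★ `smul_iota_Emap_eq_H46P_Dfix`, ★★★ `smul_iota_T47_eq_chart_pinv` — (G22)ᴾ (a)(b) under the Sect. C regime `Regime H̃ᴾ 0 C̃ b 0 C₂ᵣ c₄ 0 a_C εC` + the displayed B13 rows∕windows∕radii.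
* §3 ★★★ `eventually_smul_iota_T47_eq_chart_pinv` — the assemblies' row `hchart` at the pinv letters: `∀ᶠ t in 𝓝 0, κ_f • ι(T47 H̃ᴾ C̃ εC (A₁ + Z + tδ′)) = χᴾ(κ_f • (ιA₁ + ιZ) + t•(κ_f • ιδ′))`.
* §4 ★★ `eventually_isHermitian_trace_zero_chart` — the assemblies' row `hXR` NEAR `t = 0` for a generic linear chart letter `H` (rows `hb hHop hHR hq hRε` of (51)): if `X`, `δ` are
  skew-Hermitian-traceless and `‖X‖ < ε`, then `∀ᶠ t in 𝓝 0, ∀ b′, ((−I)•χ_H(X + tδ))(b′)` is Hermitian and traceless.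
HONEST SCOPE.  Uniqueness bookkeeping + elementary topology over landed letters; the regime ∕ B13 ∕ (51) rows stay DISPLAYED; no estimate; not a proof of any stub; nothing continuum ∕ OS ∕
mass-gap ∕ Clay.
-/

set_option autoImplicit false

noncomputable section

open scoped Matrix.Norms.L2Operator Topology
open Filter Topology

namespace Summit.QuantumFields.YangMills.Theorems.Prop7ChartConjPInv

open Literature.MathematicalPhysics.QuantumFieldTheory.Balaban1983to89
open Literature.MathematicalPhysics.QuantumFieldTheory.Balaban1983to89.T3ContinuumYM3Torus
open T3SectALandauChart (eta eta_pos)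
open T3PrintedRegularMinimiser (RegPr)
open B9SectCLatticeCarrier (Bond)
open B11Eq115Space (NegSup NegSize Space115 JetSup)
open B11Eq111FrakG (nabla115)
open B13Contraction113 (QuadAnalytic)
open B11Eq174Chart (Regime)
open B11Eq90V0primeCurrent (flat115 flat115_apply)
open B11Eq90V0GroupComposed (T47)
open B11Eq80Current (Emap Emap_eq_sub)
open B11Prop3Model (Dfix)
open Summit.QuantumFields.YangMills.Theorems.Prop7SectET3Transport (periodsT3 bondEquiv bgOfCfg)
open Summit.QuantumFields.YangMills.Theorems.Prop7SymAvgTwSym (CmapTwS)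
open Summit.QuantumFields.YangMills.Theorems.Prop7SectET3CurvedPropagators (H1f)
open Summit.QuantumFields.YangMills.Theorems.Prop7SectET3DeltaPiPInv (DeltaPiSlotP H46P)
open Summit.QuantumFields.YangMills.Theorems.Prop7T47DfixBridge (Emap_eq_Dfix map_Dfix_eq_Dfix_of_conj)
open Summit.QuantumFields.YangMills.Theorems.Prop7SectET3WChartConj (iotaL_apply smul_Ctilde_eq)
open Summit.QuantumFields.YangMills.Theorems.Prop7Row79AtMemberPInv (smul_iota_H1f_eq_H46P_smul)
open Summit.QuantumFields.YangMills.Theorems.Prop7ChartRayContinuity (eventually_chart_eq_of_pointwise)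
open Summit.QuantumFields.YangMills.Theorems.Prop7FibreELOfCritSplit (isHermitian_trace_zero_chartTwS skew_add_real_smul)
open Summit.QuantumFields.YangMills.Theorems.Prop7TPrint (expHermField)

variable (F : T3Family) (n K : ℕ) (h : n ≤ K) (c₀ cB a : ℝ) [Fact (0 < c₀)] [Fact (0 < cB)] [Fact (0 < (F.L : ℝ))] [Fact (0 < ((F.L : ℝ)⁻¹) ^ (K - n))]
  (U₀ : GaugeField (F.P K) 0 (Matrix.specialUnitaryGroup (Fin 2) ℂ))

/-! ## §1 ★★ The two `Dfix` selections are conjugate at the pinv letters -/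

/-- ★★ **THE TWO SELECTORS ARE CONJUGATE ON THE NOSE, PINV LETTERS** (✓`map_Dfix_eq_Dfix_of_conj` at `r := κ_f • ι`, `s := I •`, `σ := 1`): with `C̃ := fun A′ ↦ (−I) • CmapTwS U₀ (κ_f • ιA′)` and
`H̃ᴾ := H1f …DeltaPiSlotP… U₀`, under both B13 contraction regimes and the nesting window, `I • Dfix C̃ ↑H̃ᴾ C₂′ A′ = Dfix (CmapTwS U₀) (H46P U₀) C₂ (κ_f • ιA′)`.
[cite: Balaban1985Variational, (49) p.285, (55) p.286] -/
theorem smul_iota_Dfix_eq_pinv {C₂ R b₂ ε C₂' R' b' ε' : ℝ}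
    (hC : QuadAnalytic (CmapTwS F n K h U₀) C₂ R) (hC₂ : 0 ≤ C₂) (hb₂ : 0 ≤ b₂) (hHop : ∀ X, ‖H46P F n K h c₀ cB a U₀ X‖ ≤ b₂ * ‖X‖)
    (hq : 9 * C₂ * b₂ * ε < 1) (hRC : 3 * ε ≤ R)
    (hC' : QuadAnalytic (fun A' : Space115 (F.L : ℝ) (((F.L : ℝ)⁻¹) ^ (K - n)) (fun _ : Bond 3 (periodsT3 F K) => K - n)
        (fun _ : Bond 3 (periodsT3 F K) × Fin 3 => K - n) (nabla115 (((F.L : ℝ)⁻¹) ^ (K - n)) (bgOfCfg F K U₀)) =>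
          (-Complex.I) • CmapTwS F n K h U₀ (((((eta F n K : ℝ) : ℂ)) * Complex.I) • fun b : PBond (F.P K) 0 => JetSup.equiv _ _ _ A' (bondEquiv F K b))) C₂' R')
    (hC₂' : 0 ≤ C₂') (hb' : 0 ≤ b') (hHop' : ∀ X', ‖H1f F n K h c₀ cB a (DeltaPiSlotP F n K h c₀ cB a) U₀ X'‖ ≤ b' * ‖X'‖)
    (hq' : 9 * C₂' * b' * ε' < 1) (hRC' : 3 * ε' ≤ R') (hnest : 4 * C₂' * ε' ^ 2 ≤ 4 * C₂ * ε ^ 2)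
    {A' : Space115 (F.L : ℝ) (((F.L : ℝ)⁻¹) ^ (K - n)) (fun _ : Bond 3 (periodsT3 F K) => K - n)
        (fun _ : Bond 3 (periodsT3 F K) × Fin 3 => K - n) (nabla115 (((F.L : ℝ)⁻¹) ^ (K - n)) (bgOfCfg F K U₀))}
    (hA' : ‖A'‖ < ε') (hA : ‖((((eta F n K : ℝ) : ℂ)) * Complex.I) • (fun b : PBond (F.P K) 0 => JetSup.equiv _ _ _ A' (bondEquiv F K b))‖ < ε) :
    Complex.I • Dfix (fun A' : Space115 (F.L : ℝ) (((F.L : ℝ)⁻¹) ^ (K - n)) (fun _ : Bond 3 (periodsT3 F K) => K - n)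
        (fun _ : Bond 3 (periodsT3 F K) × Fin 3 => K - n) (nabla115 (((F.L : ℝ)⁻¹) ^ (K - n)) (bgOfCfg F K U₀)) =>
          (-Complex.I) • CmapTwS F n K h U₀ (((((eta F n K : ℝ) : ℂ)) * Complex.I) • fun b : PBond (F.P K) 0 => JetSup.equiv _ _ _ A' (bondEquiv F K b)))
        (H1f F n K h c₀ cB a (DeltaPiSlotP F n K h c₀ cB a) U₀ : (PBond (F.P n) 0 → Matrix (Fin 2) (Fin 2) ℂ) →ₗ[ℂ] _) C₂' A'
      = Dfix (CmapTwS F n K h U₀) (H46P F n K h c₀ cB a U₀) C₂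
          (((((eta F n K : ℝ) : ℂ)) * Complex.I) • fun b : PBond (F.P K) 0 => JetSup.equiv _ _ _ A' (bondEquiv F K b)) := by
  have key := map_Dfix_eq_Dfix_of_conj (C := CmapTwS F n K h U₀) (hop := (H46P F n K h c₀ cB a U₀))
    (C' := fun A' : Space115 (F.L : ℝ) (((F.L : ℝ)⁻¹) ^ (K - n)) (fun _ : Bond 3 (periodsT3 F K) => K - n)
        (fun _ : Bond 3 (periodsT3 F K) × Fin 3 => K - n) (nabla115 (((F.L : ℝ)⁻¹) ^ (K - n)) (bgOfCfg F K U₀)) =>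
          (-Complex.I) • CmapTwS F n K h U₀ (((((eta F n K : ℝ) : ℂ)) * Complex.I) • fun b : PBond (F.P K) 0 => JetSup.equiv _ _ _ A' (bondEquiv F K b)))
    (hop' := (H1f F n K h c₀ cB a (DeltaPiSlotP F n K h c₀ cB a) U₀ : (PBond (F.P n) 0 → Matrix (Fin 2) (Fin 2) ℂ) →ₗ[ℂ] _))
    (((((eta F n K : ℝ) : ℂ)) * Complex.I) • ((LinearMap.funLeft ℂ (Matrix (Fin 2) (Fin 2) ℂ) (bondEquiv F K)) ∘ₗ
        ((flat115 : Space115 (F.L : ℝ) (((F.L : ℝ)⁻¹) ^ (K - n)) (fun _ : Bond 3 (periodsT3 F K) => K - n)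
          (fun _ : Bond 3 (periodsT3 F K) × Fin 3 => K - n) (nabla115 (((F.L : ℝ)⁻¹) ^ (K - n)) (bgOfCfg F K U₀)) →L[ℂ]
            (Bond 3 (periodsT3 F K) → Matrix (Fin 2) (Fin 2) ℂ)) : _ →ₗ[ℂ] _)))
    (Complex.I • (LinearMap.id : (PBond (F.P n) 0 → Matrix (Fin 2) (Fin 2) ℂ) →ₗ[ℂ] _))
    (fun B' => by rw [LinearMap.smul_apply, LinearMap.id_apply, smul_Ctilde_eq, LinearMap.smul_apply, iotaL_apply])
    (fun X' => by
      simp only [LinearMap.smul_apply, LinearMap.id_apply, iotaL_apply, ContinuousLinearMap.coe_coe]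
      exact smul_iota_H1f_eq_H46P_smul U₀ X')
    zero_le_one (fun X' => by rw [LinearMap.smul_apply, LinearMap.id_apply, norm_smul, Complex.norm_I])
    hC hC₂ hb₂ hHop hq hRC hC' hC₂' hb' (fun X' => by simpa only [ContinuousLinearMap.coe_coe] using hHop' X') hq' hRC' (by rwa [one_mul]) hA'
    (by rwa [LinearMap.smul_apply, iotaL_apply])
  rwa [LinearMap.smul_apply, LinearMap.id_apply, LinearMap.smul_apply, iotaL_apply] at key

/-! ## §2 ★★★ (G22)ᴾ: the selector inside `W80` at the pinv letters IS the EX display's pinv chart, on the nose -/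

/-- ★★★ **(G22)ᴾ (a): `κ_f • ι(Emap H̃ᴾ C̃ εC A′) = H46P U₀ (Dfix (CmapTwS U₀) (H46P U₀) C₂ (κ_f • ιA′))`** under the Sect. C regime of `(H̃ᴾ, C̃)`, both B13 regimes, the nesting windows
`4C₂′bε′² ≤ εC`, `4C₂′ε′² ≤ 4C₂ε²`, and the radii. [cite: Balaban1985Variational, (47)–(49) p.285, (55) p.286, (80) p.290, Prop. 6 p.295] -/
theorem smul_iota_Emap_eq_H46P_Dfix {b C₂ᵣ c₄ aC εC C₂ R b₂ ε C₂' R' ε' : ℝ}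
    (RC : Regime (H1f F n K h c₀ cB a (DeltaPiSlotP F n K h c₀ cB a) U₀) 0
      (fun A' : Space115 (F.L : ℝ) (((F.L : ℝ)⁻¹) ^ (K - n)) (fun _ : Bond 3 (periodsT3 F K) => K - n)
        (fun _ : Bond 3 (periodsT3 F K) × Fin 3 => K - n) (nabla115 (((F.L : ℝ)⁻¹) ^ (K - n)) (bgOfCfg F K U₀)) =>
          (-Complex.I) • CmapTwS F n K h U₀ (((((eta F n K : ℝ) : ℂ)) * Complex.I) • fun b : PBond (F.P K) 0 => JetSup.equiv _ _ _ A' (bondEquiv F K b)))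
      b 0 C₂ᵣ c₄ 0 aC εC)
    (hC : QuadAnalytic (CmapTwS F n K h U₀) C₂ R) (hC₂ : 0 ≤ C₂) (hb₂ : 0 ≤ b₂) (hHop : ∀ X, ‖H46P F n K h c₀ cB a U₀ X‖ ≤ b₂ * ‖X‖)
    (hq : 9 * C₂ * b₂ * ε < 1) (hRC : 3 * ε ≤ R)
    (hC' : QuadAnalytic (fun A' : Space115 (F.L : ℝ) (((F.L : ℝ)⁻¹) ^ (K - n)) (fun _ : Bond 3 (periodsT3 F K) => K - n)
        (fun _ : Bond 3 (periodsT3 F K) × Fin 3 => K - n) (nabla115 (((F.L : ℝ)⁻¹) ^ (K - n)) (bgOfCfg F K U₀)) =>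
          (-Complex.I) • CmapTwS F n K h U₀ (((((eta F n K : ℝ) : ℂ)) * Complex.I) • fun b : PBond (F.P K) 0 => JetSup.equiv _ _ _ A' (bondEquiv F K b))) C₂' R')
    (hC₂' : 0 ≤ C₂') (hq' : 9 * C₂' * b * ε' < 1) (hRC' : 3 * ε' ≤ R') (hwin : 4 * C₂' * b * ε' ^ 2 ≤ εC) (hnest : 4 * C₂' * ε' ^ 2 ≤ 4 * C₂ * ε ^ 2)
    {A' : Space115 (F.L : ℝ) (((F.L : ℝ)⁻¹) ^ (K - n)) (fun _ : Bond 3 (periodsT3 F K) => K - n)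
        (fun _ : Bond 3 (periodsT3 F K) × Fin 3 => K - n) (nabla115 (((F.L : ℝ)⁻¹) ^ (K - n)) (bgOfCfg F K U₀))}
    (hA'C : ‖A'‖ < aC) (hA' : ‖A'‖ < ε') (hA : ‖((((eta F n K : ℝ) : ℂ)) * Complex.I) • (fun b : PBond (F.P K) 0 => JetSup.equiv _ _ _ A' (bondEquiv F K b))‖ < ε) :
    ((((eta F n K : ℝ) : ℂ)) * Complex.I) • (fun b : PBond (F.P K) 0 => JetSup.equiv _ _ _
        (Emap (H1f F n K h c₀ cB a (DeltaPiSlotP F n K h c₀ cB a) U₀)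
          (fun A' : Space115 (F.L : ℝ) (((F.L : ℝ)⁻¹) ^ (K - n)) (fun _ : Bond 3 (periodsT3 F K) => K - n)
            (fun _ : Bond 3 (periodsT3 F K) × Fin 3 => K - n) (nabla115 (((F.L : ℝ)⁻¹) ^ (K - n)) (bgOfCfg F K U₀)) =>
              (-Complex.I) • CmapTwS F n K h U₀ (((((eta F n K : ℝ) : ℂ)) * Complex.I) • fun b : PBond (F.P K) 0 => JetSup.equiv _ _ _ A' (bondEquiv F K b)))
          εC A') (bondEquiv F K b))
      = H46P F n K h c₀ cB a U₀ (Dfix (CmapTwS F n K h U₀) (H46P F n K h c₀ cB a U₀) C₂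
          (((((eta F n K : ℝ) : ℂ)) * Complex.I) • fun b : PBond (F.P K) 0 => JetSup.equiv _ _ _ A' (bondEquiv F K b))) := by
  rw [Emap_eq_Dfix RC hC' hC₂' RC.B₀_nonneg RC.norm_G hq' hRC' hwin hA'C hA', smul_iota_H1f_eq_H46P_smul,
    smul_iota_Dfix_eq_pinv F n K h c₀ cB a U₀ hC hC₂ hb₂ hHop hq hRC hC' hC₂' RC.B₀_nonneg RC.norm_G hq' hRC' hnest hA' hA]

/-- ★★★ **(G22)ᴾ (b): `κ_f • ι(T47 H̃ᴾ C̃ εC A′) = χᴾ(κ_f • ιA′)` with the EX display's pinv chart `χᴾ X := X − H46P U₀ (Dfix (CmapTwS U₀) (H46P U₀) C₂ X)`** (same hypotheses as (a)).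
[cite: Balaban1985Variational, (47)–(49) p.285, (55) p.286, (80) p.290, Prop. 6 p.295] -/
theorem smul_iota_T47_eq_chart_pinv {b C₂ᵣ c₄ aC εC C₂ R b₂ ε C₂' R' ε' : ℝ}
    (RC : Regime (H1f F n K h c₀ cB a (DeltaPiSlotP F n K h c₀ cB a) U₀) 0
      (fun A' : Space115 (F.L : ℝ) (((F.L : ℝ)⁻¹) ^ (K - n)) (fun _ : Bond 3 (periodsT3 F K) => K - n)
        (fun _ : Bond 3 (periodsT3 F K) × Fin 3 => K - n) (nabla115 (((F.L : ℝ)⁻¹) ^ (K - n)) (bgOfCfg F K U₀)) =>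
          (-Complex.I) • CmapTwS F n K h U₀ (((((eta F n K : ℝ) : ℂ)) * Complex.I) • fun b : PBond (F.P K) 0 => JetSup.equiv _ _ _ A' (bondEquiv F K b)))
      b 0 C₂ᵣ c₄ 0 aC εC)
    (hC : QuadAnalytic (CmapTwS F n K h U₀) C₂ R) (hC₂ : 0 ≤ C₂) (hb₂ : 0 ≤ b₂) (hHop : ∀ X, ‖H46P F n K h c₀ cB a U₀ X‖ ≤ b₂ * ‖X‖)
    (hq : 9 * C₂ * b₂ * ε < 1) (hRC : 3 * ε ≤ R)
    (hC' : QuadAnalytic (fun A' : Space115 (F.L : ℝ) (((F.L : ℝ)⁻¹) ^ (K - n)) (fun _ : Bond 3 (periodsT3 F K) => K - n)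
        (fun _ : Bond 3 (periodsT3 F K) × Fin 3 => K - n) (nabla115 (((F.L : ℝ)⁻¹) ^ (K - n)) (bgOfCfg F K U₀)) =>
          (-Complex.I) • CmapTwS F n K h U₀ (((((eta F n K : ℝ) : ℂ)) * Complex.I) • fun b : PBond (F.P K) 0 => JetSup.equiv _ _ _ A' (bondEquiv F K b))) C₂' R')
    (hC₂' : 0 ≤ C₂') (hq' : 9 * C₂' * b * ε' < 1) (hRC' : 3 * ε' ≤ R') (hwin : 4 * C₂' * b * ε' ^ 2 ≤ εC) (hnest : 4 * C₂' * ε' ^ 2 ≤ 4 * C₂ * ε ^ 2)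
    {A' : Space115 (F.L : ℝ) (((F.L : ℝ)⁻¹) ^ (K - n)) (fun _ : Bond 3 (periodsT3 F K) => K - n)
        (fun _ : Bond 3 (periodsT3 F K) × Fin 3 => K - n) (nabla115 (((F.L : ℝ)⁻¹) ^ (K - n)) (bgOfCfg F K U₀))}
    (hA'C : ‖A'‖ < aC) (hA' : ‖A'‖ < ε') (hA : ‖((((eta F n K : ℝ) : ℂ)) * Complex.I) • (fun b : PBond (F.P K) 0 => JetSup.equiv _ _ _ A' (bondEquiv F K b))‖ < ε) :
    ((((eta F n K : ℝ) : ℂ)) * Complex.I) • (fun b : PBond (F.P K) 0 => JetSup.equiv _ _ _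
        (T47 (H1f F n K h c₀ cB a (DeltaPiSlotP F n K h c₀ cB a) U₀)
          (fun A' : Space115 (F.L : ℝ) (((F.L : ℝ)⁻¹) ^ (K - n)) (fun _ : Bond 3 (periodsT3 F K) => K - n)
            (fun _ : Bond 3 (periodsT3 F K) × Fin 3 => K - n) (nabla115 (((F.L : ℝ)⁻¹) ^ (K - n)) (bgOfCfg F K U₀)) =>
              (-Complex.I) • CmapTwS F n K h U₀ (((((eta F n K : ℝ) : ℂ)) * Complex.I) • fun b : PBond (F.P K) 0 => JetSup.equiv _ _ _ A' (bondEquiv F K b)))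
          εC A') (bondEquiv F K b))
      = ((((eta F n K : ℝ) : ℂ)) * Complex.I) • (fun b : PBond (F.P K) 0 => JetSup.equiv _ _ _ A' (bondEquiv F K b))
          - H46P F n K h c₀ cB a U₀ (Dfix (CmapTwS F n K h U₀) (H46P F n K h c₀ cB a U₀) C₂
              (((((eta F n K : ℝ) : ℂ)) * Complex.I) • fun b : PBond (F.P K) 0 => JetSup.equiv _ _ _ A' (bondEquiv F K b))) := by
  have hE := smul_iota_Emap_eq_H46P_Dfix F n K h c₀ cB a U₀ RC hC hC₂ hb₂ hHop hq hRC hC' hC₂' hq' hRC' hwin hnest hA'C hA' hA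
  have hT : ∀ b : PBond (F.P K) 0, JetSup.equiv _ _ _ (T47 (H1f F n K h c₀ cB a (DeltaPiSlotP F n K h c₀ cB a) U₀)
      (fun A' : Space115 (F.L : ℝ) (((F.L : ℝ)⁻¹) ^ (K - n)) (fun _ : Bond 3 (periodsT3 F K) => K - n)
        (fun _ : Bond 3 (periodsT3 F K) × Fin 3 => K - n) (nabla115 (((F.L : ℝ)⁻¹) ^ (K - n)) (bgOfCfg F K U₀)) =>
          (-Complex.I) • CmapTwS F n K h U₀ (((((eta F n K : ℝ) : ℂ)) * Complex.I) • fun b : PBond (F.P K) 0 => JetSup.equiv _ _ _ A' (bondEquiv F K b)))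
      εC A') (bondEquiv F K b)
      = JetSup.equiv _ _ _ A' (bondEquiv F K b) - JetSup.equiv _ _ _ (Emap (H1f F n K h c₀ cB a (DeltaPiSlotP F n K h c₀ cB a) U₀)
          (fun A' : Space115 (F.L : ℝ) (((F.L : ℝ)⁻¹) ^ (K - n)) (fun _ : Bond 3 (periodsT3 F K) => K - n)
            (fun _ : Bond 3 (periodsT3 F K) × Fin 3 => K - n) (nabla115 (((F.L : ℝ)⁻¹) ^ (K - n)) (bgOfCfg F K U₀)) =>
              (-Complex.I) • CmapTwS F n K h U₀ (((((eta F n K : ℝ) : ℂ)) * Complex.I) • fun b : PBond (F.P K) 0 => JetSup.equiv _ _ _ A' (bondEquiv F K b)))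
          εC A') (bondEquiv F K b) := fun b => by
    rw [Emap_eq_sub, JetSup.equiv_sub, Pi.sub_apply, sub_sub_cancel]
  rw [← hE]
  funext b
  simp only [Pi.smul_apply, Pi.sub_apply, hT, smul_sub]

/-! ## §3 ★★★ The assemblies' row `hchart` at the pinv letters, eventually along the ray -/

/-- ★★★ **`hchart` AT THE MEMBER, PINV LETTERS**: (G22)ᴾ made eventual along the ray `A₁ + Z + t•δ′` from a base point STRICTLY inside the three radii — the literal `hchart` row of
✓`Prop7Eq128AtMemberOfCrit127.inner_toL2_residual_eq_zero_of_hCrit127_of_hasDerivAt_actionZ` ∕ ✓`Prop7Crit93AtMemberOfRow84.deriv_chartRay_eq_zero_of_eq111_of_hasDerivAt_actionZ_chart`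
at `Tc := T47 H̃ᴾ C̃ εC`, `χ := χᴾ`, `Z := H₁f B̃` (✓`eventually_chart_eq_of_pointwise`). [cite: Balaban1985Variational, (47)–(49) p.285, (55) p.286, (82)–(84) p.290, (112) p.294] -/
theorem eventually_smul_iota_T47_eq_chart_pinv {b C₂ᵣ c₄ aC εC C₂ R b₂ ε C₂' R' ε' : ℝ}
    (RC : Regime (H1f F n K h c₀ cB a (DeltaPiSlotP F n K h c₀ cB a) U₀) 0
      (fun A' : Space115 (F.L : ℝ) (((F.L : ℝ)⁻¹) ^ (K - n)) (fun _ : Bond 3 (periodsT3 F K) => K - n)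
        (fun _ : Bond 3 (periodsT3 F K) × Fin 3 => K - n) (nabla115 (((F.L : ℝ)⁻¹) ^ (K - n)) (bgOfCfg F K U₀)) =>
          (-Complex.I) • CmapTwS F n K h U₀ (((((eta F n K : ℝ) : ℂ)) * Complex.I) • fun b : PBond (F.P K) 0 => JetSup.equiv _ _ _ A' (bondEquiv F K b)))
      b 0 C₂ᵣ c₄ 0 aC εC)
    (hC : QuadAnalytic (CmapTwS F n K h U₀) C₂ R) (hC₂ : 0 ≤ C₂) (hb₂ : 0 ≤ b₂) (hHop : ∀ X, ‖H46P F n K h c₀ cB a U₀ X‖ ≤ b₂ * ‖X‖)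
    (hq : 9 * C₂ * b₂ * ε < 1) (hRC : 3 * ε ≤ R)
    (hC' : QuadAnalytic (fun A' : Space115 (F.L : ℝ) (((F.L : ℝ)⁻¹) ^ (K - n)) (fun _ : Bond 3 (periodsT3 F K) => K - n)
        (fun _ : Bond 3 (periodsT3 F K) × Fin 3 => K - n) (nabla115 (((F.L : ℝ)⁻¹) ^ (K - n)) (bgOfCfg F K U₀)) =>
          (-Complex.I) • CmapTwS F n K h U₀ (((((eta F n K : ℝ) : ℂ)) * Complex.I) • fun b : PBond (F.P K) 0 => JetSup.equiv _ _ _ A' (bondEquiv F K b))) C₂' R')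
    (hC₂' : 0 ≤ C₂') (hq' : 9 * C₂' * b * ε' < 1) (hRC' : 3 * ε' ≤ R') (hwin : 4 * C₂' * b * ε' ^ 2 ≤ εC) (hnest : 4 * C₂' * ε' ^ 2 ≤ 4 * C₂ * ε ^ 2)
    (A₁ Z δ' : Space115 (F.L : ℝ) (((F.L : ℝ)⁻¹) ^ (K - n)) (fun _ : Bond 3 (periodsT3 F K) => K - n) (fun _ : Bond 3 (periodsT3 F K) × Fin 3 => K - n)
      (nabla115 (((F.L : ℝ)⁻¹) ^ (K - n)) (bgOfCfg F K U₀)))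
    (hA'C : ‖A₁ + Z‖ < aC) (hA' : ‖A₁ + Z‖ < ε')
    (hA : ‖((((eta F n K : ℝ) : ℂ)) * Complex.I) • ((fun b : PBond (F.P K) 0 => JetSup.equiv _ _ _ A₁ (bondEquiv F K b))
            + (fun b : PBond (F.P K) 0 => JetSup.equiv _ _ _ Z (bondEquiv F K b)))‖ < ε) :
    ∀ᶠ t : ℝ in 𝓝 0,
      ((((eta F n K : ℝ) : ℂ)) * Complex.I) • (fun b : PBond (F.P K) 0 => JetSup.equiv _ _ _
          (T47 (H1f F n K h c₀ cB a (DeltaPiSlotP F n K h c₀ cB a) U₀)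
            (fun A' : Space115 (F.L : ℝ) (((F.L : ℝ)⁻¹) ^ (K - n)) (fun _ : Bond 3 (periodsT3 F K) => K - n)
              (fun _ : Bond 3 (periodsT3 F K) × Fin 3 => K - n) (nabla115 (((F.L : ℝ)⁻¹) ^ (K - n)) (bgOfCfg F K U₀)) =>
                (-Complex.I) • CmapTwS F n K h U₀ (((((eta F n K : ℝ) : ℂ)) * Complex.I) • fun b : PBond (F.P K) 0 => JetSup.equiv _ _ _ A' (bondEquiv F K b)))
            εC (A₁ + Z + (t : ℂ) • δ')) (bondEquiv F K b))
        = ((((eta F n K : ℝ) : ℂ)) * Complex.I) • ((fun b : PBond (F.P K) 0 => JetSup.equiv _ _ _ A₁ (bondEquiv F K b))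
                + (fun b : PBond (F.P K) 0 => JetSup.equiv _ _ _ Z (bondEquiv F K b)))
              + (t : ℂ) • (((((eta F n K : ℝ) : ℂ)) * Complex.I) • fun b : PBond (F.P K) 0 => JetSup.equiv _ _ _ δ' (bondEquiv F K b))
          - H46P F n K h c₀ cB a U₀ (Dfix (CmapTwS F n K h U₀) (H46P F n K h c₀ cB a U₀) C₂
              (((((eta F n K : ℝ) : ℂ)) * Complex.I) • ((fun b : PBond (F.P K) 0 => JetSup.equiv _ _ _ A₁ (bondEquiv F K b))
                + (fun b : PBond (F.P K) 0 => JetSup.equiv _ _ _ Z (bondEquiv F K b)))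
              + (t : ℂ) • (((((eta F n K : ℝ) : ℂ)) * Complex.I) • fun b : PBond (F.P K) 0 => JetSup.equiv _ _ _ δ' (bondEquiv F K b)))) :=
  eventually_chart_eq_of_pointwise U₀
    (χ := fun X : PBond (F.P K) 0 → Matrix (Fin 2) (Fin 2) ℂ => X - H46P F n K h c₀ cB a U₀ (Dfix (CmapTwS F n K h U₀) (H46P F n K h c₀ cB a U₀) C₂ X))
    (fun _ h1 h2 h3 => smul_iota_T47_eq_chart_pinv F n K h c₀ cB a U₀ RC hC hC₂ hb₂ hHop hq hRC hC' hC₂' hq' hRC' hwin hnest h1 h2 h3) A₁ Z δ' hA'C hA' hA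

/-! ## §4 ★★ The assemblies' row `hXR` near `t = 0`: the chart value along the ray is `𝔰𝔲(2)`-valued -/

/-- ★★ **`hXR` NEAR `t = 0`, GENERIC LINEAR CHART LETTER `H`**: at `U₀ ∈ 𝔘_k(ε₀)` in the windows of (51) (`10⁹L²e ≤ 1`, `10¹²L³ε₀ ≤ 1`, `‖H Y‖ ≤ b‖Y‖`, `H` real, `9C₂bε < 1`, `6ε ≤ eη`), if
`X` and `δ` are skew-Hermitian-traceless and `‖X‖ < ε`, then for all `t` near `0` every bond value of `(−I) • ((X + tδ) − H(Dfix (CmapTwS U₀) H C₂ (X + tδ)))` is Hermitian and traceless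
(✓`isHermitian_trace_zero_chartTwS` on the open ball + continuity of the ray) — the `hXR` row of ✓`Prop7Eq128AtMemberOfCrit127` at `δ := κ_f • ιδ′` (instance `H := H46P U₀` by `exact`).
[cite: Balaban1985Variational, (51) p.286, (47) p.285, (82) p.290] -/
theorem eventually_isHermitian_trace_zero_chart {ε₀ e b ε : ℝ} (hε₀ : 0 < ε₀) (he : 0 < e) (hWe : 10 ^ 9 * (F.L : ℝ) ^ 2 * e ≤ 1) (hWε : 10 ^ 12 * (F.L : ℝ) ^ 3 * ε₀ ≤ 1)
    (hreg : RegPr F n K ε₀ U₀)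
    {H : (PBond (F.P n) 0 → Matrix (Fin 2) (Fin 2) ℂ) →ₗ[ℂ] (PBond (F.P K) 0 → Matrix (Fin 2) (Fin 2) ℂ)} (hb : 0 ≤ b) (hHop : ∀ Y, ‖H Y‖ ≤ b * ‖Y‖)
    (hHR : ∀ Y : PBond (F.P n) 0 → Matrix (Fin 2) (Fin 2) ℂ, (∀ c, star (Y c) = -Y c ∧ (Y c).trace = 0) → ∀ b', star (H Y b') = -H Y b' ∧ (H Y b').trace = 0)
    (hq : 9 * (40 * (2 * (3 * (2 * e + 2700 * (F.L : ℝ) * ε₀))) / (e * eta F n K) ^ 2) * b * ε < 1) (hRε : 6 * ε ≤ e * eta F n K)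
    {X δ : PBond (F.P K) 0 → Matrix (Fin 2) (Fin 2) ℂ} (hXε : ‖X‖ < ε) (hXR : ∀ b', star (X b') = -X b' ∧ (X b').trace = 0)
    (hδR : ∀ b', star (δ b') = -δ b' ∧ (δ b').trace = 0) :
    ∀ᶠ t : ℝ in 𝓝 0, ∀ b' : PBond (F.P K) 0,
      (((-Complex.I) • ((X + (t : ℂ) • δ) - H (Dfix (CmapTwS F n K h U₀) H (40 * (2 * (3 * (2 * e + 2700 * (F.L : ℝ) * ε₀))) / (e * eta F n K) ^ 2) (X + (t : ℂ) • δ)))) b').IsHermitian ∧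
      Matrix.trace (((-Complex.I) • ((X + (t : ℂ) • δ) - H (Dfix (CmapTwS F n K h U₀) H (40 * (2 * (3 * (2 * e + 2700 * (F.L : ℝ) * ε₀))) / (e * eta F n K) ^ 2) (X + (t : ℂ) • δ)))) b') = 0 := by
  have hc : Continuous fun t : ℝ => X + (t : ℂ) • δ := continuous_const.add (Complex.continuous_ofReal.smul continuous_const)
  have hball : ∀ᶠ t : ℝ in 𝓝 0, ‖X + (t : ℂ) • δ‖ < ε :=
    (hc.norm.continuousAt (x := (0 : ℝ))).eventually_lt continuousAt_const (by simpa only [Complex.ofReal_zero, zero_smul, add_zero] using hXε)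
  filter_upwards [hball] with t ht
  exact isHermitian_trace_zero_chartTwS F h hε₀ he hWe hWε U₀ hreg hb hHop hHR hq hRε ht (skew_add_real_smul hXR hδR t)

end Summit.QuantumFields.YangMills.Theorems.Prop7ChartConjPInv

end
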